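import Literature.AlgebraicGeometry.Morphisms.FormalFunctionsGradedCechProofs
import HarnessLib

/-!
# Mittag-Leffler for `H⁰` along the infinitesimal neighbourhoods from torsion data

Sibling proofs file of `Literature/AlgebraicGeometry/Morphisms/FormalFunctionsGradedCechProofs.lean`
(graded Čech cohomology `Ȟ¹(𝒰, 𝓘^{n+1})`, connecting maps `δ_n`, transition maps `ρ`, the spans
`C_n` of the obstruction classes). There the Mittag-Leffler conclusion — for `n ≥ n₀` and `r ≫ 0`
the transition `ρ^r` kills `C_{n+r}`, so that the restriction of any `t ∈ Γ(X_{n+r}, 𝒪)` to `X_n`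
lifts to `Γ(X, 𝒪_X)` — is derived from the eventual standardness of the graded module
`C = ⊕ C_n` over the Rees algebra (Görtz–Wedhorn II, Lemma 24.40; the finiteness of
`⊕_n H¹(X, 𝓘^{n+1})`, not available in the tree). This file derives the SAME conclusion from a
different, ungraded input available for a principal ideal `I = (a)` (see
`Literature/AlgebraicGeometry/Morphisms/FormalFunctionsTorsionCech.lean`): **torsion data**, i.e. a
Noetherian `A`-module `H` and `A`-linear maps `Ψ_r : Ȟ¹(𝒰, 𝓘^{n₀+r+1}) → H` with
`Ψ_r ∘ ρ = a • Ψ_{r+1}` and `Ψ_0` injective. Then (`InfinitesimalCech.exists_restrict_eq_of_torsionData`):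
for `x ∈ C_{n₀+r}` one has `a^{n₀+r+1} x = 0` (`smul_eq_zero_of_mem_C`), hence
`Ψ_r x ∈ H[a^∞] = H[a^N]` (torsion stabilises in the Noetherian module `H`), hence
`Ψ_0 (ρ^r x) = a^r Ψ_r x = 0` for `r ≥ N`, hence `ρ^r x = 0`; with `x = δ_{n₀+r} t` this is
`δ_{n₀} (t|_{X_{n₀}}) = 0`, and `t|_{X_{n₀}}` lifts (`exists_restrict_eq_of_δ_eq_zero`). This is the
classical proof of the theorem on formal functions for `H⁰` along a Cartier-type divisor via the
stabilisation of `a`-power torsion (cf. The Stacks Project, Tag 02OB, Cohomology of Schemes,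
Lemma 30.20.1, and the `(ML)` condition of Tag 0594), used in
`Literature/AlgebraicGeometry/Morphisms/ZariskiConnectednessProjective.lean` for Zariski's
connectedness theorem over a Noetherian base without the graded finiteness theorem.

The iterated inclusions `e : X_n → X_{n+r}` are produced existentially
(`InfinitesimalCech.exists_incl_ρIter_δ`: `e ≫ ι_{n+r} = ι_n` and `ρ^r ∘ δ_{n+r} = δ_n ∘ e^*`), so
that the file declares theorems only; no named facts are introduced.

## References

* The Stacks Project, Tag 02OB (Cohomology of Schemes, Lemma 30.20.1), Tag 02OC (Theorem 30.20.5),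
  Tag 0594 (Mittag-Leffler systems).
* U. Görtz, T. Wedhorn, *Algebraic Geometry II*, Springer Spektrum (2023), Lemma 24.40.
-/

noncomputable section

open CategoryTheory AlgebraicGeometry Limits TopologicalSpace Opposite

universe u v

namespace Literature.AlgebraicGeometry.Morphisms

namespace InfinitesimalCech

open infinitesimalNeighbourhood

variable {A : Type u} [CommRing A] (I : Ideal A) {X : Scheme.{u}} (f : X ⟶ Spec (.of A))
  {ι' : Type v} (U : ι' → X.Opens) (hU : ∀ i, IsAffineOpen (U i))

/-- The iterated transition closed immersions `e : X_n → X_{n+r}` (compatible with the immersions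
into `X`) and `ρ^r (δ_{n+r} t) = δ_n (t|_{X_n})` along them (iterate `ρ_δ`). [folklore] -/
theorem exists_incl_ρIter_δ (n : ℕ) : ∀ r : ℕ,
    ∃ e : infinitesimalNeighbourhood I f n ⟶ infinitesimalNeighbourhood I f (n + r),
      e ≫ ι I f (n + r) = ι I f n ∧
        ∀ t : Γ(infinitesimalNeighbourhood I f (n + r), ⊤),
          ρIter I f U n r (δ I f U hU (n + r) t) = δ I f U hU n (e.appTop.hom t)
  | 0 => ⟨𝟙 _, Category.id_comp _, fun t ↦ by
      rw [ρIter_zero, Scheme.Hom.id_appTop]; rfl⟩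
  | r + 1 => by
    obtain ⟨e, he, hρ⟩ := exists_incl_ρIter_δ n r
    refine ⟨e ≫ transition I f (n + r), by rw [Category.assoc, transition_ι, he], fun t ↦ ?_⟩
    show ρIter I f U n r (ρ I f U (n + r) (δ I f U hU (n + r + 1) t)) = _
    rw [ρ_δ, hρ, Scheme.Hom.comp_appTop]
    rfl

/-- Torsion by powers of `a` in a Noetherian module stabilises: there is `N` with
`H[a^k] = H[a^N]` for all `k ≥ N`. [folklore] -/
theorem exists_torsionBy_pow_stable {H : Type*} [AddCommGroup H] [Module A H] [IsNoetherian A H]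
    (a : A) : ∃ N : ℕ, ∀ k, N ≤ k → ∀ h : H, a ^ k • h = 0 → a ^ N • h = 0 := by
  let T : ℕ →o Submodule A H :=
    { toFun := fun k ↦ Submodule.torsionBy A H (a ^ k)
      monotone' := fun k l hkl h hh ↦ by
        rw [Submodule.mem_torsionBy_iff] at hh ⊢
        obtain ⟨d, rfl⟩ := Nat.exists_eq_add_of_le hkl
        rw [add_comm, pow_add, mul_smul, hh, smul_zero] }
  obtain ⟨N, hN⟩ := (monotone_stabilizes_iff_noetherian.mpr inferInstance) T
  refine ⟨N, fun k hk h hh ↦ ?_⟩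
  have hmem : h ∈ T k := (Submodule.mem_torsionBy_iff _ _).mpr hh
  rw [← hN k hk] at hmem
  exact (Submodule.mem_torsionBy_iff _ _).mp hmem

include hU in
/-- **Mittag-Leffler for `H⁰` from torsion data.** Let `a ∈ I`, and suppose given a Noetherian
`A`-module `H` and `A`-linear maps `Ψ_r : Ȟ¹(𝒰, 𝓘^{n₀+r+1}) → H` (`r ≥ 0`) with
`Ψ_r (ρ x) = a • Ψ_{r+1} x` and `Ψ_0` injective. Then there is `N` such that for all `r ≥ N` and
all `t ∈ Γ(X_{n₀+r}, 𝒪)` the restriction `t|_{X_{n₀}}` lifts to `Γ(X, 𝒪_X)`: with `x = δ_{n₀+r} t`,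
`a^{n₀+r+1} x = 0` (`smul_eq_zero_of_mem_C`), so `Ψ_r x` is `a`-power torsion, `= 0` after `a^N`
(torsion stabilises), whence `Ψ_0 (ρ^r x) = a^r Ψ_r x = 0`, `ρ^r x = 0`, i.e.
`δ_{n₀} (t|_{X_{n₀}}) = 0` (`exists_incl_ρIter_δ`), and `exists_restrict_eq_of_δ_eq_zero` applies.
[cite: StacksProject, Tag 02OB (Cohomology of Schemes, Lemma 30.20.1) and Tag 0594 (Mittag-Leffler)] -/
theorem exists_restrict_eq_of_torsionData (hcov : ⨆ i, U i = ⊤) {a : A} (ha : a ∈ I) {n₀ : ℕ}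
    {H : Type*} [AddCommGroup H] [Module A H] [IsNoetherian A H]
    (Ψ : (r : ℕ) → (H1 I f U (n₀ + r) →ₗ[A] H))
    (hΨ : ∀ (r : ℕ) (x : H1 I f U (n₀ + r + 1)), Ψ r (ρ I f U (n₀ + r) x) = a • Ψ (r + 1) x)
    (hinj : Function.Injective (Ψ 0)) :
    ∃ N : ℕ, ∀ r, N ≤ r →
      ∃ e : infinitesimalNeighbourhood I f n₀ ⟶ infinitesimalNeighbourhood I f (n₀ + r),
        e ≫ ι I f (n₀ + r) = ι I f n₀ ∧
          ∀ t : Γ(infinitesimalNeighbourhood I f (n₀ + r), ⊤),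
            ∃ m : Γ(X, ⊤), restrict I f n₀ m = e.appTop.hom t := by
  obtain ⟨N, hN⟩ := exists_torsionBy_pow_stable (H := H) a
  refine ⟨N, fun r hr ↦ ?_⟩
  obtain ⟨e, he, heρ⟩ := exists_incl_ρIter_δ I f U hU n₀ r
  refine ⟨e, he, fun t ↦ ?_⟩
  -- `Ψ_0 ∘ ρ^r = a^r • Ψ_r`
  have key : ∀ (r : ℕ) (x : H1 I f U (n₀ + r)), Ψ 0 (ρIter I f U n₀ r x) = a ^ r • Ψ r x := by
    intro r
    induction r with
    | zero => intro x; rw [ρIter_zero, pow_zero, one_smul]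
    | succ r ih => intro x; rw [ρIter_succ, ih, hΨ, ← mul_smul, ← pow_succ]
  set x := δ I f U hU (n₀ + r) t with hx
  -- `a^{n₀+r+1} x = 0`, so `Ψ_r x` is torsion, killed by `a^N`, hence by `a^r`
  have hkill : a ^ (n₀ + r + 1) • x = 0 :=
    smul_eq_zero_of_mem_C I f U hU (Ideal.pow_mem_pow ha _) (δ_mem_C I f U hU _ t)
  have htors : a ^ (n₀ + r + 1) • Ψ r x = 0 := by rw [← map_smul, hkill, map_zero]
  have hN' : a ^ N • Ψ r x = 0 := hN (n₀ + r + 1) (by omega) _ htors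
  have hr' : a ^ r • Ψ r x = 0 := by
    obtain ⟨d, hd⟩ := Nat.exists_eq_add_of_le hr
    have e : a ^ r = a ^ d * a ^ N := by rw [hd, pow_add, mul_comm]
    rw [e, mul_smul, hN', smul_zero]
  -- hence `ρ^r x = 0`, i.e. `δ_{n₀} (t|_{X_{n₀}}) = 0`
  have hρ : ρIter I f U n₀ r x = 0 := hinj (by rw [key, hr', map_zero])
  rw [hx, heρ] at hρ
  exact exists_restrict_eq_of_δ_eq_zero I f U hU hcov hρ

end InfinitesimalCech

end Literature.AlgebraicGeometry.Morphisms

end
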